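import Mathlib.Algebra.Order.BigOperators.Ring.Finset
import Mathlib.Algebra.BigOperators.Ring.Finset
import Mathlib.Algebra.BigOperators.Field
import Mathlib.Data.Fintype.BigOperators
import Mathlib.Data.Real.Basic
import Mathlib.Tactic.Positivity
import Mathlib.Tactic.FieldSimp
import Mathlib.Tactic.GCongr
import Mathlib.Tactic.Linarith
import Mathlib.Tactic.Ring
import HarnessLib

/-!
# Chebyshev's inequality for the empirical mean of independent trials, arbitrary finite weights

Topic `Literature/Computability/Complexity`; companion of `MajorityVoteWeighted.lean` (Chebyshev
majority vote for an EVENT, `1/(4mη²)`), `SamplingDeviationPMF.lean` (the same for a general one-trial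
law, measure form) and `MedianOfMeans.lean` (Hoeffding + the median trick).  Those three bound the
deviation of a COUNT of good trials; estimation procedures whose one-shot estimator is a bounded REAL
random variable with a known variance (e.g. the classical-shadow estimator of a Pauli observable,
variance `≤ 3^k`, `Literature/InformationTheory/QuantumLearning/ClassicalShadows.lean`) need the
textbook Chebyshev bound for the empirical MEAN, which this file supplies in the same finite
"product weight" language: one trial has finitely many outcomes `a : α` with weights `w a ≥ 0`,
`∑ w = 1`, a real value `Z a` with mean `μ = ∑ w·Z` and variance `∑ w·(Z − μ)² ≤ σ²`; `m` independent
trials are the sequences `ω : Fin m → α` weighted by `∏ᵢ w (ω i)`.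

**Result** (`sum_weight_mean_far_le`): the product weight of `{ω : |(1/m)∑ᵢ Z(ωᵢ) − μ| ≥ η}` is at
most `σ²/(m η²)` (`η > 0`, `m ≥ 1`) — Chebyshev's inequality applied to the empirical mean, whose
variance is `σ²/m` by Bienaymé's identity (independent summands).  This is the step "`K` independent
sample means of size `N = 34σ²/ε²` suffice …" in Huang–Kueng–Preskill's proof of the classical-shadow
sample-complexity theorem, there combined with the median trick of `MedianOfMeans.lean`.

Proof: entirely finite.  The one- and two-coordinate marginals of the product weight
(`∑_ω (∏ w(ωₖ))·h(ωᵢ) = ∑ w·h`, and `∑_ω (∏ w(ωₖ))·f(ωᵢ)g(ωⱼ) = (∑ w f)(∑ w g)` for `i ≠ j`) follow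
from `Fintype.prod_sum`; expanding the square gives Bienaymé
`∑_ω (∏ w(ωₖ))·(∑ᵢ (Z(ωᵢ) − μ))² = m·∑ w (Z − μ)²`, and Markov's step `1 ≤ D²/(mη)²` on the bad set
finishes.  No measure theory, no named facts.

## References
* S. Arora, B. Barak, *Computational Complexity: A Modern Approach*, CUP 2009, Appendix A,
  Lemma A.12 (Chebyshev's inequality) [AroraBarak2009].
* H.-Y. Huang, R. Kueng, J. Preskill, *Predicting many properties of a quantum system from very few
  measurements*, Nature Physics 16 (2020) 1050–1057 = arXiv:2002.08953, Supplementary Information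
  §1.B, proof of Theorem S1 (sample means of size `N = 34σ²/ε²`, then median of means)
  [HuangKuengPreskill2020].
-/

noncomputable section

namespace Literature.Computability.Complexity

open Finset

variable {α : Type*} [Fintype α]

/-- One-coordinate marginal of a product weight: `∑_ω (∏ₖ w(ωₖ))·h(ωᵢ) = ∑ₐ w a·h a` when
`∑ w = 1`. [folklore] -/
private theorem sum_prodWeight_mul_apply (w : α → ℝ) (hw1 : ∑ a, w a = 1) {m : ℕ} (i : Fin m)
    (h : α → ℝ) :
    ∑ ω : Fin m → α, (∏ k, w (ω k)) * h (ω i) = ∑ a, w a * h a := by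
  have key : ∀ ω : Fin m → α,
      (∏ k, w (ω k)) * h (ω i) = ∏ k, (w (ω k) * if k = i then h (ω k) else 1) := by
    intro ω
    rw [Finset.prod_mul_distrib, Finset.prod_ite_eq']
    simp
  simp_rw [key]
  rw [← Fintype.prod_sum (fun k a => w a * if k = i then h a else 1)]
  rw [Finset.prod_eq_single_of_mem i (Finset.mem_univ _)]
  · simp
  · intro k _ hk
    rw [Finset.sum_congr rfl fun a _ => by rw [if_neg hk, mul_one]]
    exact hw1

/-- Two-coordinate marginal of a product weight (independence): for `i ≠ j`,
`∑_ω (∏ₖ w(ωₖ))·f(ωᵢ)·g(ωⱼ) = (∑ w f)(∑ w g)` when `∑ w = 1`. [folklore] -/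
private theorem sum_prodWeight_mul_apply_mul_apply (w : α → ℝ) (hw1 : ∑ a, w a = 1) {m : ℕ}
    {i j : Fin m} (hij : i ≠ j) (f g : α → ℝ) :
    ∑ ω : Fin m → α, (∏ k, w (ω k)) * (f (ω i) * g (ω j)) =
      (∑ a, w a * f a) * ∑ a, w a * g a := by
  have key : ∀ ω : Fin m → α, (∏ k, w (ω k)) * (f (ω i) * g (ω j)) =
      ∏ k, (w (ω k) * ((if k = i then f (ω k) else 1) * (if k = j then g (ω k) else 1))) := by
    intro ω
    rw [Finset.prod_mul_distrib, Finset.prod_mul_distrib, Finset.prod_ite_eq',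
      Finset.prod_ite_eq']
    simp
  simp_rw [key]
  rw [← Fintype.prod_sum (fun k a =>
    w a * ((if k = i then f a else 1) * (if k = j then g a else 1)))]
  have hj : j ∈ (Finset.univ : Finset (Fin m)).erase i :=
    Finset.mem_erase.2 ⟨hij.symm, Finset.mem_univ _⟩
  rw [← Finset.mul_prod_erase _ _ (Finset.mem_univ i), ← Finset.mul_prod_erase _ _ hj,
    Finset.prod_eq_one, mul_one]
  · simp [hij, hij.symm]
  · intro k hk
    simp only [Finset.mem_erase, Finset.mem_univ, and_true] at hk
    rw [Finset.sum_congr rfl fun a _ => by rw [if_neg hk.2, if_neg hk.1, mul_one, mul_one]]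
    exact hw1

/-- **Bienaymé's identity in product-weight form**: the variance of a sum of `m` independent
copies is `m` times the one-trial variance,
`∑_ω (∏ w(ωₖ))·(∑ᵢ (Z(ωᵢ) − μ))² = m · ∑ w (Z − μ)²` (`μ = ∑ w Z`, `∑ w = 1`). [folklore] -/
private theorem sum_prodWeight_mul_sq_sum_sub (w : α → ℝ) (hw1 : ∑ a, w a = 1) (Z : α → ℝ)
    {μ : ℝ} (hμ : ∑ a, w a * Z a = μ) (m : ℕ) :
    ∑ ω : Fin m → α, (∏ k, w (ω k)) * (∑ i, (Z (ω i) - μ)) ^ 2 =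
      m * ∑ a, w a * (Z a - μ) ^ 2 := by
  have h0 : ∑ a, w a * (Z a - μ) = 0 := by
    simp [mul_sub, Finset.sum_sub_distrib, hμ, ← Finset.sum_mul, hw1]
  calc ∑ ω : Fin m → α, (∏ k, w (ω k)) * (∑ i, (Z (ω i) - μ)) ^ 2
      = ∑ ω : Fin m → α, ∑ i, ∑ j, (∏ k, w (ω k)) * ((Z (ω i) - μ) * (Z (ω j) - μ)) := by
        refine Finset.sum_congr rfl fun ω _ => ?_
        rw [sq, Finset.sum_mul_sum, Finset.mul_sum]
        refine Finset.sum_congr rfl fun i _ => ?_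
        rw [Finset.mul_sum]
    _ = ∑ i, ∑ j, ∑ ω : Fin m → α, (∏ k, w (ω k)) * ((Z (ω i) - μ) * (Z (ω j) - μ)) := by
        rw [Finset.sum_comm]
        exact Finset.sum_congr rfl fun i _ => Finset.sum_comm
    _ = ∑ i : Fin m, ∑ j : Fin m, (if i = j then ∑ a, w a * (Z a - μ) ^ 2 else 0) := by
        refine Finset.sum_congr rfl fun i _ => Finset.sum_congr rfl fun j _ => ?_
        split_ifs with hij
        · subst hij
          rw [sum_prodWeight_mul_apply w hw1 i (fun a => (Z a - μ) * (Z a - μ))]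
          simp [sq]
        · have h2 := sum_prodWeight_mul_apply_mul_apply w hw1 hij (fun a => Z a - μ) fun a => Z a - μ
          rw [h2, h0, zero_mul]
    _ = m * ∑ a, w a * (Z a - μ) ^ 2 := by
        simp [Finset.sum_ite_eq, Finset.card_univ]

/-- **Chebyshev's inequality for the empirical mean, weighted product form.** One trial: outcomes
`a : α` with weights `w a ≥ 0`, `∑ w = 1`, real value `Z a`, mean `μ = ∑ w·Z`, variance
`∑ w·(Z − μ)² ≤ σ²`.  Then for `m ≥ 1` independent trials and `η > 0` the product weight of the
outcome sequences `ω : Fin m → α` whose empirical mean `(1/m)∑ᵢ Z(ωᵢ)` is at distance `≥ η` from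
`μ` is at most `σ²/(m η²)` (`Pr[|X̄ₘ − μ| ≥ η] ≤ Var[X̄ₘ]/η² = σ²/(mη²)`).
[cite: AroraBarak2009, Appendix A Lemma A.12 (Chebyshev's inequality), applied to the mean of `m`
independent copies]; [cite: HuangKuengPreskill2020, SI §1.B proof of Theorem S1 ("independent
sample means of size N = 34σ²/ε²")] -/
theorem sum_weight_mean_far_le (w : α → ℝ) (hw : ∀ a, 0 ≤ w a) (hw1 : ∑ a, w a = 1)
    (Z : α → ℝ) {μ : ℝ} (hμ : ∑ a, w a * Z a = μ) {σ2 : ℝ}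
    (hσ : ∑ a, w a * (Z a - μ) ^ 2 ≤ σ2) {m : ℕ} (hm : 0 < m) {η : ℝ} (hη : 0 < η) :
    ∑ ω ∈ univ.filter (fun ω : Fin m → α => η ≤ |(∑ i, Z (ω i)) / m - μ|), ∏ i, w (ω i)
      ≤ σ2 / (m * η ^ 2) := by
  set D : (Fin m → α) → ℝ := fun ω => ∑ i, (Z (ω i) - μ) with hDdef
  have hm' : (0 : ℝ) < m := by exact_mod_cast hm
  have hW : ∀ ω : Fin m → α, 0 ≤ ∏ i, w (ω i) := fun ω => Finset.prod_nonneg fun i _ => hw _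
  have hD : ∀ ω : Fin m → α, (∑ i, Z (ω i)) / m - μ = D ω / m := by
    intro ω
    simp only [hDdef, Finset.sum_sub_distrib, Finset.sum_const, Finset.card_univ,
      Fintype.card_fin, nsmul_eq_mul]
    field_simp
  have hpos : (0 : ℝ) < (m : ℝ) ^ 2 * η ^ 2 := by positivity
  have hbad : ∀ ω ∈ univ.filter (fun ω : Fin m → α => η ≤ |(∑ i, Z (ω i)) / m - μ|),
      (m : ℝ) ^ 2 * η ^ 2 ≤ D ω ^ 2 := by
    intro ω hω
    rw [Finset.mem_filter, hD, abs_div, abs_of_pos hm', le_div_iff₀ hm'] at hω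
    have h1 : (m : ℝ) * η ≤ |D ω| := by rw [mul_comm]; exact hω.2
    have h2 : ((m : ℝ) * η) ^ 2 ≤ |D ω| ^ 2 := pow_le_pow_left₀ (by positivity) h1 2
    rw [sq_abs, mul_pow] at h2
    exact h2
  calc ∑ ω ∈ univ.filter (fun ω : Fin m → α => η ≤ |(∑ i, Z (ω i)) / m - μ|), ∏ i, w (ω i)
      ≤ ∑ ω ∈ univ.filter (fun ω : Fin m → α => η ≤ |(∑ i, Z (ω i)) / m - μ|),
          (∏ i, w (ω i)) * D ω ^ 2 / ((m : ℝ) ^ 2 * η ^ 2) := by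
        refine Finset.sum_le_sum fun ω hω => ?_
        rw [le_div_iff₀ hpos]
        exact mul_le_mul_of_nonneg_left (hbad ω hω) (hW ω)
    _ ≤ ∑ ω : Fin m → α, (∏ i, w (ω i)) * D ω ^ 2 / ((m : ℝ) ^ 2 * η ^ 2) :=
        Finset.sum_le_sum_of_subset_of_nonneg (Finset.filter_subset _ _)
          fun ω _ _ => div_nonneg (mul_nonneg (hW ω) (sq_nonneg _)) hpos.le
    _ = (m * ∑ a, w a * (Z a - μ) ^ 2) / ((m : ℝ) ^ 2 * η ^ 2) := by
        rw [← Finset.sum_div]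
        simp only [hDdef]
        rw [sum_prodWeight_mul_sq_sum_sub w hw1 Z hμ m]
    _ ≤ (m * σ2) / ((m : ℝ) ^ 2 * η ^ 2) := by gcongr
    _ = σ2 / (m * η ^ 2) := by
        rw [div_eq_div_iff hpos.ne' (by positivity)]
        ring

end Literature.Computability.Complexity

end
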